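import Summits.KontsevichZagierPeriods.KontsevichZagierPeriods.Theorems.TerasomaMultiplicationGammaHodgeSectorCompiler

/-!
# `GammaHodgeSector` (stmt-KontsevichZagierPeriods-3742), line `InstanceSixtySix` —
stub `stub_instanceCompiler`

The INSIDE BRANCH of the landed parametric relator compiler
`Summit.KontsevichZagierPeriods.GammaHodgeSectorKO.gammaHodgeSector_of_solvedPairs` at ONE datum:
if the Beta symbol `Σ_j [x_j,y_j] − Σ_l [x'_l,y'_l] − k·[½,½]` of a pinned pair `(r, r')` lies in
`RelSpan ⊔ ⟨sym L − sym R : (L,R) ∈ S⟩` for a set `S` of Beta-word pairs solved in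
`P = FormalRep ⧸ relations`, then under `MultiplicationAccessible` (12305) and `BetaCancellation`
(13633) the representations are equivalent. Proof verbatim from the compiler: realisation over the
pairs `relatorPairs ∪ S` (`realisation_of`), product bookkeeping (`stub_products`), and evaluation
pins the constant (`r.value = r'.value`).
-/

noncomputable section

open MeasureTheory Set
open scoped BigOperators

namespace Summit.KontsevichZagierPeriods.GammaHodgeSectorRaise66

open Literature.NumberTheory.Transcendental
open Literature.NumberTheory.Transcendental.KZ
open Literature.NumberTheory.Transcendental.BetaSymbol
open Summit.KontsevichZagierPeriods.GammaHodgeSectorKO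
open Summit.KontsevichZagierPeriods.GammaHodgeSectorNegative
open Summit.KontsevichZagierPeriods.KontsevichZagierPeriods.Theses.TerasomaMultiplication
  (GammaHodgeSector MultiplicationAccessible BetaCancellation)
open Summit.KontsevichZagierPeriods.TerasomaMultiplication.GammaHodgeFromRelators
  (realisation_of isConstMultiple_of_mem_relatorPairs betaClass_symm isConstMultiple_betaClass_transl
   betaClass_one_one betaClass_reassoc isConstMultiple_betaClass_refl)

/-- **The instance compiler** (inside branch of `gammaHodgeSector_of_solvedPairs` at one datum).
Let `S` be a set of pairs of Beta words each holding in `P` up to a positive algebraic constant.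
Under `MultiplicationAccessible` and `BetaCancellation`, for positive rational exponents, an
algebraic `c`, and a pinned pair `(r, r')` (cube Beta representation / ball-cube representation)
with equal values whose symbol `Σ_j [x_j,y_j] − Σ_l [x'_l,y'_l] − k·[½,½]` lies in
`RelSpan ⊔ ⟨sym L − sym R : (L,R) ∈ S⟩`, the representations are equivalent: realisation over the
fraction field of `P` turns the symbol congruence into `Π β(W) = κ(q)·Π β(W' ⊎ {(½,½)}^k)`, the
product bookkeeping identifies both sides with `⟦r⟧`, `κ(c)⁻¹ ⟦r'⟧`, and `r.value = r'.value`
pins `q = c`. [cite: Deligne1982HodgeCycles, Thm. 7.18] -/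
theorem stub_instanceCompiler (hM : MultiplicationAccessible) (hB : BetaCancellation)
    (S : Set (Multiset (ℚ × ℚ) × Multiset (ℚ × ℚ)))
    (hS : ∀ p ∈ S, IsConstMultiple (prodClass p.1) (prodClass p.2))
    {N N' k : ℕ} (x y : Fin N → ℚ) (x' y' : Fin N' → ℚ) (c : ℝ)
    (hx : ∀ j, 0 < x j ∧ 0 < y j) (hx' : ∀ l, 0 < x' l ∧ 0 < y' l) (hc : IsAlgebraic ℚ c)
    (hmem : wordSym x y - wordSym x' y' - k • bsym (1 / 2) (1 / 2) ∈
      RelSpan ⊔ AddSubgroup.closure ((fun p => msym p.1 - msym p.2) '' S))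
    (r : IntegralRep N) (r' : IntegralRep (2 * k + N'))
    (hr : IsCubeBetaRep x y r) (hr' : IsBallCubeRep k x' y' c r') (hv : r.value = r'.value) :
    Equivalent r r' := by
  obtain ⟨hcube, hball, hmult⟩ := stub_products
  have hEuler :=
    Summit.KontsevichZagierPeriods.KontsevichZagierPeriods.BetaCancellationLine.stub_eulerReflection
  -- the two Beta words
  set m₁ : Multiset (ℚ × ℚ) := wordMultiset x y with hm₁
  set m₂ : Multiset (ℚ × ℚ) := wordMultiset x' y' + k • ({((1:ℚ) / 2, (1:ℚ) / 2)} : Multiset (ℚ × ℚ))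
    with hm₂
  have hsym : msym m₁ - msym m₂ = wordSym x y - wordSym x' y' - k • bsym (1 / 2) (1 / 2) := by
    simp only [hm₁, hm₂, msym_add, msym_nsmul, msym_singleton, msym_wordMultiset]
    abel
  have hP₂ : prodClass m₂ = betaClass (1 / 2) (1 / 2) ^ k * ∏ l, betaClass (x' l) (y' l) := by
    rw [hm₂, prodClass_add, prodClass_nsmul, prodClass_singleton, prodClass_wordMultiset, mul_comm]
  -- realisation over the compiler pairs `relatorPairs ∪ S`
  have hreal : IsConstMultiple (prodClass m₁) (prodClass m₂) := by
    refine realisation_of hB (relatorPairs ∪ S) ?_ m₁ m₂ ?_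
    · rintro p (hp | hp)
      · exact isConstMultiple_of_mem_relatorPairs betaClass_symm isConstMultiple_betaClass_transl
          betaClass_one_one betaClass_reassoc (isConstMultiple_betaClass_refl hEuler) (hmult hM) p hp
      · exact hS p hp
    · rw [hsym]
      exact relSpan_sup_closure_le S hmem
  obtain ⟨q, hq, hq0, hqeq⟩ := hreal
  -- the two representations in `P`
  have h1 : toFormalPeriod (of r) = kap q hq * prodClass m₂ := by
    rw [← hqeq, hm₁, prodClass_wordMultiset]
    exact hcube x y r hx hr
  have h2 : toFormalPeriod (of r') = kap c hc * prodClass m₂ := by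
    rw [hP₂, ← mul_assoc]
    exact hball k x' y' c hc r' hx' hr'
  -- evaluation pins the constant
  have hE : 0 < evalP (prodClass m₂) := by
    rw [hP₂, map_mul]
    exact mul_pos (evalP_betaHalf_pow_pos k) (evalP_prod_betaClass_pos x' y' hx')
  have e1 := congrArg evalP h1
  have e2 := congrArg evalP h2
  rw [evalP_toFormalPeriod_of, map_mul, evalP_kap] at e1 e2
  rw [hv] at e1
  have hqc : q = c := mul_right_cancel₀ hE.ne' (e1.symm.trans e2)
  have h3 : toFormalPeriod (of r) = toFormalPeriod (of r') := by
    rw [h1, h2, kap_congr hq hc hqc]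
  exact toFormalPeriod_eq_iff.mp h3

end Summit.KontsevichZagierPeriods.GammaHodgeSectorRaise66

end
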